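import Summits.BirchSwinnertonDyer.BirchSwinnertonDyer.Theorems.SignedLowerHalvesKobayashiLowerHalfSemistableDefmuMuCarrier
import HarnessLib

/-!
# Line «defmu» of crux 2 `KobayashiLowerHalfSemistable` (stmt-BirchSwinnertonDyer-19000), skeleton v3: the crux BODY from the
# FIVE registered stub signatures VERBATIM (Cμ split into Cμ′ = `stub_definitePackageMuCarrier` ⊕ `stub_acMuInput`)

Route-independent `Theorems` file of the cell `bsd-ssimc`, seat `bsd-line-slh-p2` (LEAD of crux 2, gen 13); companion of
`…SemistableDefmuMuCarrier.lean` (the kernel step Cμ′ ⊕ Pollack–Weston Thm. 2.5 ⟹ Cμ) and of `…SemistableDefmuAssemblyStubs.lean`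
(p630247: the body from the FOUR v2 stubs). HONEST FRAMING: nothing about any curve is asserted, NO summit statement is proved,
BSD / the crux is NOT proved; the one theorem is an IMPLICATION from hypotheses displayed in full.

* `kobayashiLowerHalfSemistable_body_of_stubs₅` — the BODY of the route decl `Theses.SignedLowerHalves.KobayashiLowerHalfSemistable`
  (`∀ W p, p ≠ 2 → ClassX6 W p → ∃ ε, KobayashiLowerDivisibility W p ε`; this file does not import the route file) from the FIVE
  stub signatures of the skeleton of record v3 `Cruxes/KobayashiLowerHalfSemistable/Lines/defmu.lean`, VERBATIM and in
  registration order: `stub_ramifiedLevelPrimeR` (S1aʳ, `h1a`), `stub_definitePackageMuCarrier` (Cμ′, `hC'`: the BSTW signed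
  two-variable package at the definite-CR datum whose anticyclotomic unit-content conjunct is replaced by a DEFINITE `μ`-CARRIER
  `(S, φ, T)` of type `(N/q₀, q₀)` with `T.HasMuZeroLAc p φ → HasUnitContent (UnrSeries₂.minus Lsig)` — BSTW-II §2.2.2 (def):
  "(𝓛^{∘,ac}_p(g_{/L})) = (∏ c_q(g) · 𝓛^∘_𝒲(g_{/L}))", `μ`-shadow, WEAKER than print), `stub_acMuInput` (`hPW`: Pollack–Weston
  2011 Thm. 2.5 (i) BY NAME, `pollackWeston2011_thm_2_5_hasMuZeroLAc`, a PUBLISHED named fact — "`μ(𝓛^∘_𝒲(g_{/L})) = 0` by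
  [PW]"), `stub_namedInputsTwo` (`h6`), `stub_threeResidual` (S7, `h7`). Proof: `SemistableDefmuMuCarrier.exists_package_of_muCarrier`
  rebuilds the v2 stub Cμ pointwise from `hC'` ⊕ `hPW`, then p630247's `kobayashiLowerHalfSemistable_body_of_stubs`.
  So the by-name closer of the item, once the five stubs are theorems `T1a TC' TPW TN T3`, is
  `kobayashiLowerHalfSemistable_body_of_stubs₅ T1a TC' TPW TN T3` — exactly the v3 skeleton's `KobayashiLowerHalfSemistable_of`.

Stub ledger of v3 (numbers, not adjectives): S1aʳ PUB-conditional (p625644); Cμ′ PRE (props118 binder ⊕ BSTW-II §2.2.2 (def)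
comparison ⊕ the definite carrier: Eichler / Jacquet–Langlands / PW Lemma 2.1 / BD96 Lemma 2.2); `stub_acMuInput` PUB, NAMED
(`pollackWeston2011_thm_2_5_hasMuZeroLAc`); `NamedInputs₂` HELD (2 PRE + 4 PUB by name); S7 the `p = 3` residual (BSTW `p = 3`
tier). Kernel state of the crux: UNCHANGED (OPEN; PRE). Nothing of BSTW is asserted.

References: [BurungaleSkinnerTianWan2024] arXiv:2409.01350v2 II §2.2.2–§2.3, Props. 1.18/2.7/5.19, Thm. 6.17, Thm. 9.24, Thm. 1.3
(p = 3); [PollackWeston2011] Thm. 2.5 (i); [DarmonIovita2008] §2.2; [Kobayashi2003] Conj. (p. 2), Thms. 1.2/4.1; [Ribet1990]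
Thm. 1.1; [Diamond1995RefinedSerre] Thm. 1.1; cell files `Cruxes/KobayashiLowerHalfSemistable/{Lines/defmu.lean, PICKED.md}`.
-/

-- D-0017: single-problem summit, the namespace repeats the problem name by design.
set_option linter.dupNamespace false
set_option autoImplicit false

noncomputable section

open scoped Classical

open NumberField IsDedekindDomain Field CongruenceSubgroup
open Literature.NumberTheory.GaloisRepresentations
open Literature.NumberTheory.EllipticCurves Literature.NumberTheory.EllipticCurves.BurungaleSkinnerTianWan2024
open Literature.NumberTheory.EllipticCurves.ModularForms
open Literature.NumberTheory.Automorphic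

namespace Summit.BirchSwinnertonDyer.BirchSwinnertonDyer.Theorems.SemistableDefmuMuCarrierStubs

/-- **The BODY of crux 2 `Theses.SignedLowerHalves.KobayashiLowerHalfSemistable` from the FIVE registered stub signatures of
skeleton v3 VERBATIM** (`h1a` = `stub_ramifiedLevelPrimeR`, `hC'` = `stub_definitePackageMuCarrier`, `hPW` = `stub_acMuInput`,
`h6` = `stub_namedInputsTwo`, `h7` = `stub_threeResidual`): for every globally minimal `W/ℚ` and prime `p ≠ 2` with `ClassX6 W p`,
`∃ ε, KobayashiLowerDivisibility W p ε`. The v2 stub Cμ is rebuilt pointwise from `hC'` (definite `μ`-carrier) and `hPW`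
(Pollack–Weston Thm. 2.5 by name) by `SemistableDefmuMuCarrier.exists_package_of_muCarrier`; the rest is p630247's
`SemistableDefmuAssemblyStubs.kobayashiLowerHalfSemistable_body_of_stubs` (`5 ≤ p` via p629660, `p = 3` via `h7`).
CONDITIONAL; closes nothing; the item stays OPEN (PRE). [cite: BurungaleSkinnerTianWan2024, Thm. 1.3, §2.2.2–§2.3]
[cite: PollackWeston2011, Thm. 2.5 (i)] [cite: Kobayashi2003, Conjecture (Main Conjecture) (p. 2)] -/
theorem kobayashiLowerHalfSemistable_body_of_stubs₅
    (h1a :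
      ∀ (p : ℕ) [Fact p.Prime] (W : WeierstrassCurve ℚ) [W.IsElliptic] [W.IsGloballyMinimal],
        5 ≤ p → Rank1Residual.ClassX6 W p →
        ∃ q₀ : ℕ, q₀.Prime ∧ (q₀ : ℤ) ∣ W.conductorNorm ℤ ∧ ¬ ((p : ℤ) ∣ padicValRat q₀ W.Δ))
    (hC' :
      ∀ {p : ℕ} [Fact p.Prime] (ι : PadicAlgCl p ≃+* ℂ) (W : WeierstrassCurve ℚ) [W.IsElliptic]
        [W.IsGloballyMinimal] (K : Type) [Field K] [NumberField K] (v vbar : HeightOneSpectrum (𝓞 K))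
        (κ₁ κ₂ : ZpExtension K p) (γ₁ γ₂ : absoluteGaloisGroup K)
        [Fact (ZpExtension.IsTopGeneratorPair κ₁ κ₂ γ₁ γ₂)] {N : ℕ} [NeZero N] (f : CuspForm (Gamma0 N) 2)
        [NeZero (NumberField.discr K).natAbs],
        IsNewformOf W f → (N : ℤ) = W.conductorNorm ℤ → p ≠ 2 → ¬ (p : ℤ) ∣ W.conductorNorm ℤ →
        W.frobeniusTrace p = 0 →
        IsImaginaryQuadratic K → ((Ideal.span {(p : ℤ)}).primesOver (𝓞 K)).ncard = 2 →
        ((p : ℕ) : 𝓞 K) ∈ v.asIdeal → ((p : ℕ) : 𝓞 K) ∈ vbar.asIdeal → vbar ≠ v →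
        (∀ (w : InfinitePlace K) (k : 𝓞 K), k ∈ v.asIdeal ↔ ‖ι.symm (w.embedding (k : K))‖ < 1) →
        IsCoprime (N : ℤ) (NumberField.discr K) →
        -- ⟨definite-CR datum, rev 5: X6 at 5 ≤ p; ONE prime q₀ ∥ N inert in K, every other ℓ ∣ N split; `2` split or
        --  `2 ∣ N` ((spl) of BSTW Thm 9.24); (CR, RAMIFIED branch only) `p ∤ v_{q₀}(Δ_W)` (ρ̄ ramified at q₀, `p ∤ c_{q₀}`)⟩
        5 ≤ p → Rank1Residual.ClassX6 W p →
        ∀ q₀ : ℕ, q₀.Prime → q₀ ∣ N → ¬ (q₀ ^ 2 ∣ N) →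
          ((Ideal.span {(q₀ : ℤ)}).primesOver (𝓞 K)).ncard = 1 →
          (∀ ℓ : ℕ, ℓ.Prime → ℓ ∣ N → ℓ ≠ q₀ → ((Ideal.span {(ℓ : ℤ)}).primesOver (𝓞 K)).ncard = 2) →
          (((Ideal.span {(2 : ℤ)}).primesOver (𝓞 K)).ncard = 2 ∨ 2 ∣ N) →
          ¬ ((p : ℤ) ∣ padicValRat q₀ W.Δ) →
        (∀ ρ : ModPGaloisRep K (ZMod p) 2, (W.baseChange K).IsTorsionGaloisRep p ρ →
          FramedRep.IsAbsolutelyIrreducible ρ) →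
        κ₁.IsCyclotomic → κ₂.IsAnticyclotomic →
        ∀ (Ω δ : ℂ) (Ωp : (unrIntegers p)ˣ) (LK G : PowerSeries (PowerSeries (PadicComplexInt p))),
          Ω ≠ 0 → (δ ^ 2 = (NumberField.discr K : ℂ) ∨ δ ^ 2 = -(NumberField.discr K : ℂ)) →
          IsKatzMeasure₂ ι v vbar ∅ κ₁ κ₂ γ₁⁻¹ γ₂⁻¹ 1 Ω δ ((Ωp : unrIntegers p) : PadicComplex p) LK →
          IsGreenbergLFunctionAnyRoot₂ ι v vbar κ₁ κ₂ γ₁⁻¹ γ₂⁻¹ f (NumberField.discr K).natAbs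
            (NumberField.classNumber K) LK G →
        ∀ J : ℤ_[p] →+* PadicComplexInt p,
          (∀ x : ℤ_[p], ((J x : PadicComplexInt p) : PadicComplex p) = ((x : ℚ_[p]) : PadicComplex p)) →
        ∀ ε : ℤˣ,
        ∃ xi Lsig : PowerSeries (PowerSeries (PadicComplexInt p)),
          (∃ (S : Brandt.XiSetup (N / q₀) q₀) (_ : Fintype (Brandt.ClassSet S.O))
              (φ : Brandt.ClassSet S.O → ℤ) (T : GrossPointTower K S p),
              φ ≠ 0 ∧
              Brandt.eigenLattice (N / q₀ * q₀) (Brandt.matrix S.O) (fun n => W.LFunction n) = ℤ ∙ φ ∧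
              (∃ c : Brandt.ClassSet S.O, ¬ (p : ℤ) ∣ (Brandt.weight S.O c : ℤ) * φ c) ∧
              (T.HasMuZeroLAc p φ → GreenbergVatsal2000.HasUnitContent (UnrSeries₂.minus Lsig))) ∧
          (Ideal.span {xi * G} =
              (WeierstrassCurve.XGr₂.charIdeal (W.baseChange K) p κ₁ κ₂ vbar γ₁ γ₂).map
                  (IwasawaAlgebra₂.toUnr₂ p J) * Ideal.span {Lsig} ∧
          ∀ (κ : ZpExtension ℚ p) (γ : absoluteGaloisGroup ℚ), κ.IsCyclotomic → κ.IsTopGenerator γ →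
            IsCyclotomicVariable p γ →
            (∃ ζ : ℤ_[p]ˣ, IsOfFinOrder ζ ∧
              GaloisRep.cyclotomicCharacter ℚ p γ * ζ = GaloisRep.cyclotomicCharacter K p γ₁) →
            ∀ (W₂ : WeierstrassCurve ℚ) [W₂.IsElliptic] [W₂.IsGloballyMinimal]
              (C₂ : WeierstrassCurve.VariableChange ℚ),
              C₂ • W₂ = W.quadraticTwist (NumberField.discr K : ℚ) →
              (∀ (D₁ : Kobayashi2003.SignedSelmerDualData W κ γ ε)
                  (D₂ : Kobayashi2003.SignedSelmerDualData W₂ κ γ ε) (g₁ g₂ : IwasawaAlgebra p),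
                  D₁.charIdeal = Ideal.span {g₁} → D₂.charIdeal = Ideal.span {g₂} →
                  UnrSeries₂.plus xi ∣ PowerSeries.map J (g₁ * g₂)) ∧
              (∀ {N₂ : ℕ} [NeZero N₂] (f₂ : CuspForm (Gamma0 N₂) 2), IsNewformOf W₂ f₂ →
                ∀ (L₁ L₂ : IwasawaAlgebra p), Kobayashi2003.IsSignedPAdicLFunction f p ε L₁ →
                  Kobayashi2003.IsSignedPAdicLFunction f₂ p ε L₂ →
                  ∃ u : PowerSeries (PadicComplexInt p), IsUnit u ∧
                    UnrSeries₂.plus Lsig = u * PowerSeries.map J (L₁ * L₂))))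
    (hPW :
      ∀ (K : Type) [Field K] [NumberField K] {Nplus Nminus : ℕ} (S : Brandt.XiSetup Nplus Nminus)
        (p : ℕ) [Fact p.Prime] (W : WeierstrassCurve ℚ), pollackWeston2011_thm_2_5_hasMuZeroLAc K S p W)
    (h6 :
      (thm617_exists_isGreenbergLFunctionAnyRoot₂_supersingular_PRE ∧
        Kobayashi2003.thm12_signedSelmerDual_finite_torsion ∧ Kobayashi2003.thm41_signedCharIdeal_divisibility ∧
        nonempty_modularParametrizationData ∧ realPeriodRat_eq_unit_mul_plusPeriod) ∧
        thm924_greenberg_dvd_charIdealXGr₂_awayFromCyc_OPEN)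
    (h7 :
      ∀ (W : WeierstrassCurve ℚ) [W.IsElliptic] [W.IsGloballyMinimal], Rank1Residual.ClassX6 W 3 →
        ∃ ε : ℤˣ, Summit.BirchSwinnertonDyer.Rank1Residual.Supersingular.KobayashiLowerDivisibility W 3 ε) :
    ∀ (W : WeierstrassCurve ℚ) [W.IsElliptic] [W.IsGloballyMinimal] (p : ℕ) [Fact p.Prime], p ≠ 2 →
      Rank1Residual.ClassX6 W p →
      ∃ ε : ℤˣ, Summit.BirchSwinnertonDyer.Rank1Residual.Supersingular.KobayashiLowerDivisibility W p ε := by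
  refine SemistableDefmuAssemblyStubs.kobayashiLowerHalfSemistable_body_of_stubs h1a ?_ h6 h7
  intro p _ ι W _ _ K _ _ v vbar κ₁ κ₂ γ₁ γ₂ _ N _ f _ hf hN hp hpN ha0 hIQ hsp hv hvbar hvv hι hcop h5 hX q₀ hq₀ hqN hq2
    hin hspl h2K hCR hirr hκ₁ hκ₂ Ω δ Ωp LK G hΩ hδ hLK hGr J hJ ε
  exact SemistableDefmuMuCarrier.exists_package_of_muCarrier hPW W K vbar κ₁ κ₂ γ₁ γ₂ f hN hp ha0 hIQ hsp hcop hX hq₀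
    hqN hq2 hin hspl G J ε
    (hC' ι W K v vbar κ₁ κ₂ γ₁ γ₂ f hf hN hp hpN ha0 hIQ hsp hv hvbar hvv hι hcop h5 hX q₀ hq₀ hqN hq2 hin hspl h2K hCR
      hirr hκ₁ hκ₂ Ω δ Ωp LK G hΩ hδ hLK hGr J hJ ε)

end Summit.BirchSwinnertonDyer.BirchSwinnertonDyer.Theorems.SemistableDefmuMuCarrierStubs

end
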